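/-
Copyright (c) 2026 the pub-hodgecm-mathlib formalisation cell (harness21).  Prover seat hodgecm-mathlib-K2Liu-p07 (g3), Track B «K2-LIT»,
#184♮ = hLiu418 = `stmt-HodgeConjecture-24832`; #42S payer road, organ S1 (local Siegel–Weil spanning), ROAD W file F7r-4
(LEAD F0P6-plan (g14) RULING «M-158a» (4)∕ADDENDUM (3); referee K2Liu-ref1 (g5) AUDIT-AW2 «SIGN (M4)», R2; census K2Liu-p07 (g3) 12:3xZ on `K2/STATUS.md`).
-/
import Summits.HodgeConjecture.HodgeConjecture.Theorems.K2LiuLocalSWRamifiedRelativeSign     -- ★ F7r-1: witness calculus, `Ad(d_a)` stabilities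
import HarnessLib

/-!
# Crux `HLiu418`, #42S organ S1, ROAD W, file F7r-4: THE OFF-BIG-CELL EIGEN-RELATION (H-mid) OF THE RAMIFIED WITNESS, CELL BY CELL —
# `F(Ad_{d_a} g) = χ_s(ℓ₁)·F(g)` ON `P_Δ` AND ON `P_Δ w₁ P_Δ` FROM `F(1) = 0` AND THE DILATION INVARIANCE `F(w₁ · Ad_{d_a} x) = F(w₁ x)`

Cell `hodgecm-mathlib`, crux item hLiu418 = `stmt-HodgeConjecture-24832`; squad K2 ∕ K2Liu; LEAD F0P6-plan (g14), organ lead K2Liu-p06 (g4);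
prover K2Liu-p07 (g3).  THEOREMS ONLY (no `def`, no instance, no notation, no named-fact hypothesis, no `sorry`); lane
`--supports stmt-HodgeConjecture-24832 --as helper`.

WHY.  ★ F7r-1 `offBigCell_add_mul_comp` turns the socket binder `hf₀off` for the ramified witness `f₀ = F + μ·(F ∘ Ad d_a)` into the ONE eigen-relation
(H-mid) `F(Ad_{d_a} g) = κ₁·F(g)` off the big cell `Ω = P_Δ w_Δ N_Δ`, `κ₁ = χ_s(ℓ₁)` (`= −1` for Kudla's CM datum, ★ F7r-2).  For `n = 2` the complement of
`Ω` is the closed cell `P_Δ` and the middle cell `P_Δ w₁ P_Δ` (`w₁` the flip of ONE line; the assembly glues this Bruhat decomposition, organ lead's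
SPEC-S1 §3∕§4); this file proves (H-mid) ON EACH OF THE TWO CELLS, by value, for any `P_Δ`-preserving endomorphism `θ` fixing the inducing character
with `θ w₁ = ℓ₁ w₁`, `ℓ₁ ∈ P_Δ` (★ F7r-2 `localCongr_dA_flip` for `θ = Ad(d_a)`):
* CLOSED CELL: `F(θ p) = κ·F(p)` for every `κ` as soon as `F(1) = 0` (`ΓΦ(0) = 0` for the lattice pair — witness hand);
* MIDDLE CELL: `F(θ(p w₁ x)) = χ_s(ℓ₁)·F(p w₁ x)` for `p, x ∈ P_Δ` as soon as **(d) `F(w₁ · θ x) = F(w₁ · x)` for `x ∈ P_Δ`** — the DILATION INVARIANCE of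
  the middle-cell restriction (referee's R2 `middleCell_swSectionLoc_comp_Ad_dUnit`; for the organ's lattice-pair witness it is the ideal-indicator shape of the
  middle profile, letter (m1) `K2LiuLatticePairMiddleProfile`), since `θ(p w₁ x) = θp · ℓ₁ · w₁ · θx` and `χ_s(θ p) = χ_s(p)`;
* for `θ = Ad(d_a)`: Levi-type elements (`B = C = 0` in the adapted matrix) are FIXED (`localCongr_dA_eq_self_of_blkB_blkC`) and `Ad(d_a) n(t) = n(a⁻¹t)`
  (★ `localCongr_dA_nElem`), so (d) is a statement about `t ↦ F(w₁ m n(t))` under `t ↦ a⁻¹t` (`apply_flip_mul_localCongr_dA_mul`).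
* `offBigCell_comp_eq_of_cells` — (H-mid) in the socket's letters from the two cells and the cell decomposition `hcell` (by value).
References: [Kudla1994] §3 Thm. 3.1; [HarrisKudlaSweet1996] §1 (1.11), (1.15); [KudlaSweet1997] §1; [BernsteinZelevinsky1976] §1.5.
HONEST LABEL.  Count-neutral helper: `HC_CM` is proved only modulo the 7 printed citations (2 remaining named inputs: hLiu418 = `stmt-HodgeConjecture-24832`,
h413 = `stmt-HodgeConjecture-24833`) until rung 0 closes.
-/

set_option autoImplicit false
set_option linter.dupNamespace false -- the mandated namespace repeats `HodgeConjecture.HodgeConjecture`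

noncomputable section

open scoped Matrix
open NumberField IsDedekindDomain Matrix
open Literature.NumberTheory.Automorphic Literature.NumberTheory.Automorphic.UnitaryGroup
open Literature.NumberTheory.GelbartRogawski1991.AdaptedBlocks
open Literature.NumberTheory.GelbartRogawski1991.UnitaryDualPair.LocalSplitting
open Literature.NumberTheory.K2Lit.LocalSiegelDoubled
open Summit.HodgeConjecture.HodgeConjecture.Cruxes.HLiu418.K2LiuLocalSWSimilitudeAlgebra
open Summit.HodgeConjecture.HodgeConjecture.Cruxes.HLiu418.K2LiuLocalSWSimilitudeSections
open Summit.HodgeConjecture.HodgeConjecture.Cruxes.HLiu418.K2LiuLocalSWRamifiedRelativeSign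

namespace Summit.HodgeConjecture.HodgeConjecture.Cruxes.HLiu418.K2LiuLocalSWRamifiedMiddleCell

variable (F : Type) [Field F] [NumberField F] (E : Type) [Field E] [NumberField E] [Algebra F E] [Algebra.IsQuadraticExtension F E]
  (c : E ≃ₐ[F] E) {δ : E} (hcδ : c δ = -δ) (hδ : δ ≠ 0) {d : F} (hd : δ * δ = algebraMap F E d)
  (v : HeightOneSpectrum (𝓞 F)) (n : ℕ) {T₀ : Matrix (Fin n) (Fin n) F} (hT₀ : T₀.IsSymm)
  {JD : Matrix (Fin (n + n)) (Fin (n + n)) E} (hJD : JD = (gramD F n T₀).map (algebraMap F E))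
  (χv : ∀ w : PlacesOver E v, (w.1.adicCompletion E)ˣ →* ℂˣ) (s : ℂ)

/-! ## §1 The two cells, by value, for a `P_Δ`-preserving endomorphism `θ` -/

section Generic

variable (θ : UnitaryGroup.localPi E c (n + n) JD v →* UnitaryGroup.localPi E c (n + n) JD v)
  (hθP : ∀ p, IsSiegelDelta F E c hcδ hδ hd v n hT₀ hJD p → IsSiegelDelta F E c hcδ hδ hd v n hT₀ hJD (θ p))
  (hχθ : ∀ p, IsSiegelDelta F E c hcδ hδ hd v n hT₀ hJD p → localSiegelCharacter F E c v n χv s (θ p) = localSiegelCharacter F E c v n χv s p)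
  {F₀ : UnitaryGroup.localPi E c (n + n) JD v → ℂ} (hF : IsLocalSiegelSection F E c hcδ hδ hd v n hT₀ hJD χv s F₀)

include hθP hF in
/-- **THE CLOSED CELL**: if `F(1) = 0` then `F(θ p) = κ·F(p)` (`= 0`) on `P_Δ`, for every `κ`. [cite: Kudla1994, §3] [cite: KudlaSweet1997, §1] -/
theorem closedCell_comp_eq (h1 : F₀ 1 = 0) (κ : ℂ) (p : UnitaryGroup.localPi E c (n + n) JD v) (hp : IsSiegelDelta F E c hcδ hδ hd v n hT₀ hJD p) :
    F₀ (θ p) = κ * F₀ p := by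
  have hθp := hF (θ p) (hθP p hp) 1
  have hpp := hF p hp 1
  rw [mul_one] at hθp hpp
  rw [hθp, hpp, h1, mul_zero, mul_zero, mul_zero]

include hθP hχθ hF in
/-- **THE MIDDLE CELL**: if `θ w₁ = ℓ₁ w₁` with `ℓ₁ ∈ P_Δ` and the middle restriction is `θ`-invariant — (d) `F(w₁ · θ x) = F(w₁ · x)` for `x ∈ P_Δ` — then
`F(θ(p w₁ x)) = χ_s(ℓ₁)·F(p w₁ x)` for `p, x ∈ P_Δ`. [cite: Kudla1994, §3 Thm. 3.1] [cite: HarrisKudlaSweet1996, §1 (1.15)] -/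
theorem middleCell_comp_eq {w₁ ℓ₁ : UnitaryGroup.localPi E c (n + n) JD v} (hw₁ : θ w₁ = ℓ₁ * w₁)
    (hℓ₁ : IsSiegelDelta F E c hcδ hδ hd v n hT₀ hJD ℓ₁)
    (hd₁ : ∀ x, IsSiegelDelta F E c hcδ hδ hd v n hT₀ hJD x → F₀ (w₁ * θ x) = F₀ (w₁ * x))
    (p x : UnitaryGroup.localPi E c (n + n) JD v) (hp : IsSiegelDelta F E c hcδ hδ hd v n hT₀ hJD p) (hx : IsSiegelDelta F E c hcδ hδ hd v n hT₀ hJD x) :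
    F₀ (θ (p * w₁ * x)) = localSiegelCharacter F E c v n χv s ℓ₁ * F₀ (p * w₁ * x) := by
  rw [map_mul, map_mul, hw₁, mul_assoc, mul_assoc, hF (θ p) (hθP p hp), hF ℓ₁ hℓ₁, hd₁ x hx, hχθ p hp, mul_assoc p, hF p hp]
  ring

include hθP hχθ hF in
/-- **(H-mid) FROM THE TWO CELLS**: given the cell decomposition of the complement of the big cell (`n = 2`: `H ∖ P_Δ w_Δ N_Δ = P_Δ ⊔ P_Δ w₁ P_Δ`, by value as
`hcell`), `F(1) = 0`, `θ w₁ = ℓ₁ w₁` and (d), the eigen-relation `F(θ g) = χ_s(ℓ₁)·F(g)` holds for every `g` off the big cell — the hypothesis `hmid` of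
★ `K2LiuLocalSWRamifiedRelativeSign.offBigCell_add_mul_comp`. [cite: Kudla1994, §3 Thm. 3.1] [cite: KudlaSweet1997, §1] [cite: BernsteinZelevinsky1976, §1.5] -/
theorem offBigCell_comp_eq_of_cells {w₁ ℓ₁ : UnitaryGroup.localPi E c (n + n) JD v} (hw₁ : θ w₁ = ℓ₁ * w₁)
    (hℓ₁ : IsSiegelDelta F E c hcδ hδ hd v n hT₀ hJD ℓ₁) (h1 : F₀ 1 = 0)
    (hd₁ : ∀ x, IsSiegelDelta F E c hcδ hδ hd v n hT₀ hJD x → F₀ (w₁ * θ x) = F₀ (w₁ * x))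
    (hcell : ∀ g : UnitaryGroup.localPi E c (n + n) JD v,
      (¬ ∃ p, IsSiegelDelta F E c hcδ hδ hd v n hT₀ hJD p ∧ ∃ u ∈ unipDeltaLocal F E c v n (JD := JD), g = p * weylDelta F E c v n hJD * u) →
      IsSiegelDelta F E c hcδ hδ hd v n hT₀ hJD g ∨
        ∃ p x, IsSiegelDelta F E c hcδ hδ hd v n hT₀ hJD p ∧ IsSiegelDelta F E c hcδ hδ hd v n hT₀ hJD x ∧ g = p * w₁ * x)
    (g : UnitaryGroup.localPi E c (n + n) JD v)
    (hg : ¬ ∃ p, IsSiegelDelta F E c hcδ hδ hd v n hT₀ hJD p ∧ ∃ u ∈ unipDeltaLocal F E c v n (JD := JD), g = p * weylDelta F E c v n hJD * u) :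
    F₀ (θ g) = localSiegelCharacter F E c v n χv s ℓ₁ * F₀ g := by
  rcases hcell g hg with hgP | ⟨p, x, hp, hx, rfl⟩
  · exact closedCell_comp_eq F E c hcδ hδ hd v n hT₀ hJD χv s θ hθP hF h1 _ g hgP
  · exact middleCell_comp_eq F E c hcδ hδ hd v n hT₀ hJD χv s θ hθP hχθ hF hw₁ hℓ₁ hd₁ p x hp hx

end Generic

/-! ## §2 `θ = Ad(d_a)`: Levi-type elements are fixed; (d) is a statement about `t ↦ a⁻¹t` on the Siegel unipotents -/

section Similitude

variable (a : Fˣ) {D₀ : GL (Fin (n + n)) F}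
  (hD₀ : (D₀ : Matrix (Fin (n + n)) (Fin (n + n)) F) =
    Matrix.reindex (e₂ n) (e₂ n) (cayR F (Fin n) * Matrix.fromBlocks 1 0 0 ((a : F) • (1 : Matrix (Fin n) (Fin n) F)) * cayRinv F (Fin n)))
  {DA : GL (Fin (n + n)) E} (hDA : DA = Matrix.GeneralLinearGroup.map (algebraMap F E) D₀)
  {b : E} (hb : b ≠ 0) (hDAJ : formCongr (c : E →+* E) DA (b • JD) = JD)

omit [Algebra.IsQuadraticExtension F E] in
include hD₀ hDA in
/-- **LEVI-TYPE ELEMENTS COMMUTE WITH `d_a`**: if the adapted matrix of `m` has `B = C = 0` (e.g. `m(α)`, `ℓ_a`, `ℓ₁`), then `Ad(d_a) m = m`.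
[cite: Kudla1994, §3] [cite: HarrisKudlaSweet1996, §1 (1.11)] -/
theorem localCongr_dA_eq_self_of_blkB_blkC {m : UnitaryGroup.localPi E c (n + n) JD v} (hB : blkB (matA F E c v n m) = 0)
    (hC : blkC (matA F E c v n m) = 0) : localCongr E c DA hb hDAJ v m = m := by
  apply matA_injective F E c v n
  apply eq_of_adapt_eq
  rw [adapt_matA_localCongr_dA F E c v n a hD₀ hDA hb hDAJ, hB, hC, smul_zero, smul_zero, adapt_eq, hB, hC]

omit [Algebra.IsQuadraticExtension F E] in
include hD₀ hDA in
/-- **(d) ON A LEVI TIMES A UNIPOTENT**: `F(w₁ · Ad_{d_a}(m n(t))) = F(w₁ · m · n(a⁻¹t))` for `m` of Levi type — so (d) on `M_Δ N_Δ` is the invariance of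
`t ↦ F(w₁ m n(t))` under `t ↦ a⁻¹t`. [cite: Kudla1994, §3] [cite: HarrisKudlaSweet1996, §1 (1.15)] -/
theorem apply_flip_mul_localCongr_dA_mul (F₀ : UnitaryGroup.localPi E c (n + n) JD v → ℂ) (w₁ : UnitaryGroup.localPi E c (n + n) JD v)
    {m : UnitaryGroup.localPi E c (n + n) JD v} (hB : blkB (matA F E c v n m) = 0) (hC : blkC (matA F E c v n m) = 0)
    (t : Matrix (Fin n) (Fin n) (LocalRing E v)) (ht : (t.map (conjLocal E c v))ᵀ * gramS F E v n T₀ + gramS F E v n T₀ * t = 0) :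
    F₀ (w₁ * localCongr E c DA hb hDAJ v (m * nElem F E c v n hJD t ht)) =
      F₀ (w₁ * (m * nElem F E c v n hJD ((toLocalRing E v (((a⁻¹ : Fˣ) : F) : v.adicCompletion F)) • t)
        (by rw [Matrix.map_smul' _ _ _ (map_mul _), conjLocal_toLocalRing, Matrix.transpose_smul, Matrix.smul_mul, Matrix.mul_smul, ← smul_add, ht,
          smul_zero]))) := by
  rw [map_mul, localCongr_dA_eq_self_of_blkB_blkC F E c v n a hD₀ hDA hb hDAJ hB hC, localCongr_dA_nElem F E c v n hJD a hD₀ hDA hb hDAJ t ht]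

end Similitude

end Summit.HodgeConjecture.HodgeConjecture.Cruxes.HLiu418.K2LiuLocalSWRamifiedMiddleCell
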